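import Literature.NumberTheory.EllipticCurves.DeShalit1987.KatzPAdicLFunction
import Literature.NumberTheory.EllipticCurves.IntSeriesIdentityPrinciple
import HarnessLib

/-!
# STUB-IDEAS k1·g6 — `stub_heegnerIndexLowerAtTwo` (crux `SplitBadTwoLowerHalfOfFacts`, item
# stmt-BirchSwinnertonDyer-27851): the ODD-COSET SEQUENTIAL VALUE ENGINE for T3⁻ (the analytic VALUE
# side of LOWER at the split additive prime 2), typed.

TECHNIQUE (director): weaken / strengthen.  WEAKEST SUFFICIENT FORM of k3-g3's (W-a) ∧ (W-b) — the
`p`-adic Waldspurger / explicit-reciprocity VALUE at the 2-power ring-class character `φ_δ` and the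
Katz⊗BDP factorisation there — for the LOWER stub: NOT an identity of measures on
`Γ̃ = Gal(K₀[2^∞]/K₀) ≅ ℤ₂^×` (torsion `{±1}`; "research-L" on the Δ-keys (1,3),(1,7),(0,3),(0,7)), but ONE
limit inequality `‖G(0)‖·‖Lin‖ ≤ 2^c·‖S⋆‖²` obtained from finitely-indexed IN-RANGE identities
`Ka_n · Kb_n = w_n · S_n²` along the weight sequence `j_n = 2ⁿ − 1 → −1` (all ODD: one parity coset of
2-adic weight space `Hom(ℤ₂^×, ℂ₂^×) = {±}×disc`), three sequential continuities and a UNIFORM bound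
`‖w_n‖ ≤ 2^c`.  The torsion of `Γ̃` never enters: on the Katz side the approach to `T = 0` is through the
`v`-RAMIFIED in-range points `ε⋆·Λ^{2ⁿ}` (de Shalit 1987 II.4.14 (36)–(37), any split `p`, with the Gauss
factor `G(ε)`), on the BDP side through `θ^{2ⁿ−1} f₀^♭ → θ^{−1} f₀^♭` (q-expansion congruence
`n^{2^m} ≡ 1 (mod 2^{m+2})` for odd `n` + Katz evaluation at an ordinary CM test object) and Kriz–Li 2019
Thm. 2.8 (= Liu–Zhang–Zhang Prop. A.1: Coleman primitive = `log`, every `p`, used by them AT `p = 2`).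

§1  generic limit glue (PROVED).  §2  Katz-side sequential continuity of `IntSeries.HasValueAt` at
`T → 0` (PROVED: the one analytic input on the Katz side is kernel-checkable NOW).  §3  the valuation
currency (k3-g3-compatible names) and the PROVED chain  engine ⟹ `m/2 ≥ … ` ⟹ the LOWER exponent
inequality with the explicit constant `e_A⁻ = 4e − 2c − ρ + 2g + 2β`.  §4  the per-member WITNESS RECORD
the research stubs must deliver (a structure, no existence claimed) and the PROVED derivation of the
limit law from it.  No `sorry`; no instance; no notation.  BSD is NOT proved by any of this; S2′ / T3 is
not proved here either — this file proves the LOGIC of the engine and leaves three named research inputs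
(H_B odd-coset CM continuity at 2, H_W in-range explicit Waldspurger bound at 2, H_C Coleman-at-2
bookkeeping at conductor `2^{n_v}`), see the card.
-/

noncomputable section

open Filter Topology

namespace Summit.BirchSwinnertonDyer.BirchSwinnertonDyer.Cruxes.SplitBadTwoLowerHalfOfFacts.HeegnerIndexTwo.K1G6

open Literature.NumberTheory.EllipticCurves

/-! ### §1. Generic limit glue (PROVED) -/

/-- **Two-sided limit identity.** In-range identities `M n = w n * S n ^ 2` pass to the limit. -/
theorem eq_mul_sq_of_tendsto {𝕜 : Type*} [NormedField 𝕜] {M w S : ℕ → 𝕜} {M₀ w₀ S₀ : 𝕜}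
    (h : ∀ n, M n = w n * S n ^ 2) (hM : Tendsto M atTop (𝓝 M₀)) (hw : Tendsto w atTop (𝓝 w₀))
    (hS : Tendsto S atTop (𝓝 S₀)) : M₀ = w₀ * S₀ ^ 2 := by
  have h' : Tendsto M atTop (𝓝 (w₀ * S₀ ^ 2)) := by
    have := hw.mul (hS.pow 2)
    exact this.congr (fun n => (h n).symm)
  exact tendsto_nhds_unique hM h'

/-- **One-sided limit law (what LOWER needs).** A UNIFORM bound on the in-range constants,
`‖M n‖ ≤ C * ‖S n‖ ^ 2`, passes to the limit WITHOUT convergence of the constants. -/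
theorem norm_le_mul_sq_of_tendsto {𝕜 : Type*} [NormedField 𝕜] {M S : ℕ → 𝕜} {M₀ S₀ : 𝕜} {C : ℝ}
    (h : ∀ n, ‖M n‖ ≤ C * ‖S n‖ ^ 2) (hM : Tendsto M atTop (𝓝 M₀))
    (hS : Tendsto S atTop (𝓝 S₀)) : ‖M₀‖ ≤ C * ‖S₀‖ ^ 2 := by
  have h1 : Tendsto (fun n => ‖M n‖) atTop (𝓝 ‖M₀‖) := hM.norm
  have h2 : Tendsto (fun n => C * ‖S n‖ ^ 2) atTop (𝓝 (C * ‖S₀‖ ^ 2)) :=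
    (hS.norm.pow 2).const_mul C
  exact le_of_tendsto_of_tendsto' h1 h2 h

/-! ### §2. Katz side: sequential continuity of values of `G ∈ 𝒪_{ℂ_p}⟦T⟧` at `T → 0` (PROVED)

The S2′ frame pins the member's value as `constantCoeff G` (`T = 0`); the in-range points
`T_n = Λ̂(γ)^{2ⁿ} − 1 → 0`.  Bounded coefficients (`‖a_k‖ ≤ 1`) give
`‖G(x) − a₀‖ ≤ ∑_{k≥1} ‖x‖^k = ‖x‖/(1 − ‖x‖) → 0`: no ultrametricity, no measure, no torsion. -/

variable {p : ℕ} [Fact p.Prime]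

/-- Tail bound: a value `v` of `Q ∈ 𝒪_{ℂ_p}⟦T⟧` at `x` with `‖x‖ < 1` satisfies
`‖v − a₀‖ ≤ ‖x‖ / (1 − ‖x‖)`. -/
theorem norm_sub_constantCoeff_le_of_hasValueAt {Q : PowerSeries (PadicComplexInt p)} {x v : ℂ_[p]}
    (hx : ‖x‖ < 1) (hv : IntSeries.HasValueAt Q x v) :
    ‖v - ((PowerSeries.constantCoeff Q : PadicComplexInt p) : ℂ_[p])‖ ≤ ‖x‖ / (1 - ‖x‖) := by
  unfold IntSeries.HasValueAt at hv
  -- split off the constant term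
  have htail : HasSum (fun k : ℕ => ((PowerSeries.coeff (k + 1) Q : PadicComplexInt p) : ℂ_[p]) *
      x ^ (k + 1)) (v - ((PowerSeries.constantCoeff Q : PadicComplexInt p) : ℂ_[p])) := by
    have := (hasSum_nat_add_iff' 1).mpr hv
    simpa [Finset.sum_range_one, PowerSeries.coeff_zero_eq_constantCoeff] using this
  have hx0 : 0 ≤ ‖x‖ := norm_nonneg x
  -- termwise bound by a geometric series
  have hbound : ∀ k : ℕ, ‖((PowerSeries.coeff (k + 1) Q : PadicComplexInt p) : ℂ_[p]) * x ^ (k + 1)‖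
      ≤ ‖x‖ * ‖x‖ ^ k := by
    intro k
    rw [norm_mul, norm_pow, pow_succ]
    have hc : ‖((PowerSeries.coeff (k + 1) Q : PadicComplexInt p) : ℂ_[p])‖ ≤ 1 :=
      norm_coe_padicComplexInt_le_one _
    calc ‖((PowerSeries.coeff (k + 1) Q : PadicComplexInt p) : ℂ_[p])‖ * (‖x‖ ^ k * ‖x‖)
        ≤ 1 * (‖x‖ ^ k * ‖x‖) := by
          apply mul_le_mul_of_nonneg_right hc; positivity
      _ = ‖x‖ * ‖x‖ ^ k := by ring
  have hgeom : HasSum (fun k : ℕ => ‖x‖ * ‖x‖ ^ k) (‖x‖ * (1 - ‖x‖)⁻¹) :=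
    (hasSum_geometric_of_lt_one hx0 hx).mul_left ‖x‖
  have hsumm : Summable (fun k : ℕ => ‖((PowerSeries.coeff (k + 1) Q : PadicComplexInt p) : ℂ_[p]) *
      x ^ (k + 1)‖) :=
    Summable.of_nonneg_of_le (fun k => norm_nonneg _) hbound hgeom.summable
  rw [← htail.tsum_eq]
  calc ‖∑' k : ℕ, ((PowerSeries.coeff (k + 1) Q : PadicComplexInt p) : ℂ_[p]) * x ^ (k + 1)‖
      ≤ ∑' k : ℕ, ‖((PowerSeries.coeff (k + 1) Q : PadicComplexInt p) : ℂ_[p]) * x ^ (k + 1)‖ :=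
        norm_tsum_le_tsum_norm hsumm
    _ ≤ ∑' k : ℕ, ‖x‖ * ‖x‖ ^ k := hsumm.tsum_le_tsum hbound hgeom.summable
    _ = ‖x‖ * (1 - ‖x‖)⁻¹ := hgeom.tsum_eq
    _ = ‖x‖ / (1 - ‖x‖) := by rw [div_eq_mul_inv]

/-- **H_K (Katz-side sequential continuity, PROVED).** If `x n → 0` in `ℂ_p` and `v n` is the value of
`Q ∈ 𝒪_{ℂ_p}⟦T⟧` at `x n`, then `v n → constantCoeff Q` — the member's S2′ value `G(0)` IS the limit of
the in-range values along ANY sequence of interpolation points tending to `T = 0` (for the Δ-keys: the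
`v`-ramified points `ε⋆Λ^{2ⁿ}`, `‖T_n‖ = 2^{-n-2}`). -/
theorem tendsto_constantCoeff_of_hasValueAt {Q : PowerSeries (PadicComplexInt p)} {x v : ℕ → ℂ_[p]}
    (hx : Tendsto x atTop (𝓝 0)) (hv : ∀ n, IntSeries.HasValueAt Q (x n) (v n)) :
    Tendsto v atTop (𝓝 ((PowerSeries.constantCoeff Q : PadicComplexInt p) : ℂ_[p])) := by
  rw [tendsto_iff_norm_sub_tendsto_zero]
  have hnx : Tendsto (fun n => ‖x n‖) atTop (𝓝 0) := by
    simpa using hx.norm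
  -- eventually ‖x n‖ < 1/2, where the tail bound is ≤ 2‖x n‖
  have hev : ∀ᶠ n in atTop, ‖x n‖ < 1 / 2 := by
    exact hnx.eventually (gt_mem_nhds (by norm_num))
  have hmaj : Tendsto (fun n => 2 * ‖x n‖) atTop (𝓝 0) := by
    simpa using hnx.const_mul (2 : ℝ)
  refine squeeze_zero_norm' ?_ hmaj
  filter_upwards [hev] with n hn
  rw [Real.norm_eq_abs, abs_of_nonneg (norm_nonneg _)]
  have hx1 : ‖x n‖ < 1 := by linarith
  have h := norm_sub_constantCoeff_le_of_hasValueAt hx1 (hv n)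
  have hden : (1 : ℝ) / 2 ≤ 1 - ‖x n‖ := by linarith
  have hx0 : 0 ≤ ‖x n‖ := norm_nonneg _
  calc ‖v n - ((PowerSeries.constantCoeff Q : PadicComplexInt p) : ℂ_[p])‖
      ≤ ‖x n‖ / (1 - ‖x n‖) := h
    _ ≤ ‖x n‖ / (1 / 2) := by
        apply div_le_div_of_nonneg_left hx0 (by norm_num) hden
    _ = 2 * ‖x n‖ := by ring

/-! ### §3. The valuation currency at the point `φ_δ` (names compatible with k3-g3's package) and the
PROVED chain  engine ⟹ LOWER exponent inequality -/

/-- (V-lim) the ODD-COSET LIMIT LAW — the merged one-sided form of k3-g3's (W-a) ∧ (W-b): the product of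
the member's out-of-range Katz value `G0 = G(0)` and the partner's in-range value `Lin` is bounded by
`2^c` times the square of the BDP-side limit `S⋆` (`c` = the uniform bound on the in-range constants). -/
def OddCosetValueLaw (G0 Lin Sstar : ℂ_[2]) (c : ℤ) : Prop :=
  ‖G0‖ * ‖Lin‖ ≤ (2 : ℝ) ^ (c : ℝ) * ‖Sstar‖ ^ 2

/-- (V-col) COLEMAN AT 2, one-sided: `S⋆ = e₂ · ι_v(κ) · log_ω(P̃)` (Kriz–Li Thm. 2.8 at `p = 2` plus the
conductor-`2^{n_v}` depletion bookkeeping) has norm at most `2^{-(e + k + ℓ)}` (`e` = the explicit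
constant's order, `k = ord_v κ` of the Heegner multiplier, `ℓ` = S2′'s log binder). -/
def ColemanBoundAtTwo (Sstar : ℂ_[2]) (e k ℓ : ℤ) : Prop :=
  ‖Sstar‖ ≤ (2 : ℝ) ^ (-((e : ℝ) + k + ℓ))

/-- (W-c) Katz IN RANGE at the partner's (ramified) point: exact, de Shalit II.4.14 (36)–(37) with the
Gauss factor (`ρ/2 = n_v(δ)/2 ∈ {1, 3/2}` + the in-range constant), `a = ord` of the algebraic central
value of the rank-0 constituent. -/
def InRangeAtPhi (Lin : ℂ_[2]) (ρ a : ℤ) : Prop :=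
  ‖Lin‖ = (2 : ℝ) ^ (-(ρ : ℝ) / 2 - a)

/-- (W-d) explicit Gross–Zagier for the good pair projected to `W` (k3-g3, exact; print). -/
def ExplicitGZAtPhi (k kbar g q t τ a : ℤ) : Prop :=
  k + kbar = g + q + t - 2 * τ + a

/-- (W-e⁻) the one-sided balance of the Heegner multiplier (k3-g3 Plan 2). -/
def LowerBalanceAtPhi (k kbar β : ℤ) : Prop :=
  β ≤ k - kbar

/-- **T4 (PROVED).** The limit law + Coleman bound + in-range value give the lower bound on `m/2`,
`m/2 ≥ 2(e + k + ℓ) − ρ/2 − a − c`, for the exponent `m` of the member's value `‖G0‖ = 2^{-m/2}`. -/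
theorem half_m_lower {G0 Lin Sstar : ℂ_[2]} {c e k ℓ ρ a : ℤ} {m : ℝ}
    (hV : OddCosetValueLaw G0 Lin Sstar c) (hC : ColemanBoundAtTwo Sstar e k ℓ)
    (hI : InRangeAtPhi Lin ρ a) (hm : ‖G0‖ = (2 : ℝ) ^ (-m / 2)) :
    2 * ((e : ℝ) + k + ℓ) - (ρ : ℝ) / 2 - a - c ≤ m / 2 := by
  unfold OddCosetValueLaw at hV
  unfold ColemanBoundAtTwo at hC
  unfold InRangeAtPhi at hI
  have h2 : (1 : ℝ) < 2 := by norm_num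
  have hS0 : 0 ≤ ‖Sstar‖ := norm_nonneg _
  have hSsq : ‖Sstar‖ ^ 2 ≤ ((2 : ℝ) ^ (-((e : ℝ) + k + ℓ))) ^ 2 := by
    exact pow_le_pow_left₀ hS0 hC 2
  have hc0 : 0 ≤ (2 : ℝ) ^ (c : ℝ) := by positivity
  have hchain : (2 : ℝ) ^ (-m / 2) * (2 : ℝ) ^ (-(ρ : ℝ) / 2 - a)
      ≤ (2 : ℝ) ^ (c : ℝ) * ((2 : ℝ) ^ (-((e : ℝ) + k + ℓ))) ^ 2 := by
    rw [← hm, ← hI]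
    exact hV.trans (mul_le_mul_of_nonneg_left hSsq hc0)
  have hl : (2 : ℝ) ^ (-m / 2) * (2 : ℝ) ^ (-(ρ : ℝ) / 2 - a) = (2 : ℝ) ^ (-m / 2 + (-(ρ : ℝ) / 2 - a)) := by
    rw [← Real.rpow_add (by norm_num : (0 : ℝ) < 2)]
  have hsq : ((2 : ℝ) ^ (-((e : ℝ) + k + ℓ))) ^ 2 = (2 : ℝ) ^ (2 * (-((e : ℝ) + k + ℓ))) := by
    rw [← Real.rpow_natCast ((2 : ℝ) ^ (-((e : ℝ) + k + ℓ))) 2,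
      ← Real.rpow_mul (by norm_num : (0 : ℝ) ≤ 2)]
    congr 1
    push_cast
    ring
  have hr : (2 : ℝ) ^ (c : ℝ) * ((2 : ℝ) ^ (-((e : ℝ) + k + ℓ))) ^ 2
      = (2 : ℝ) ^ ((c : ℝ) + 2 * (-((e : ℝ) + k + ℓ))) := by
    rw [hsq, ← Real.rpow_add (by norm_num : (0 : ℝ) < 2)]
  rw [hl, hr] at hchain
  have hexp := (Real.rpow_le_rpow_left_iff h2).mp hchain
  linarith

/-- **T5 (PROVED).** Adding explicit Gross–Zagier (exact) and the one-sided balance gives the LOWER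
exponent inequality with the EXPLICIT constant `e_A⁻ := 4e − 2c − ρ + 2g + 2β` (the partner's `a`
CANCELS, as in k3-g3): `m ≥ 2(q + t − 2τ + 2ℓ) + e_A⁻`. -/
theorem m_lower_of_engine {G0 Lin Sstar : ℂ_[2]} {c e k kbar g q t τ β ℓ ρ a : ℤ} {m : ℝ}
    (hV : OddCosetValueLaw G0 Lin Sstar c) (hC : ColemanBoundAtTwo Sstar e k ℓ)
    (hI : InRangeAtPhi Lin ρ a) (hD : ExplicitGZAtPhi k kbar g q t τ a) (hE : LowerBalanceAtPhi k kbar β)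
    (hm : ‖G0‖ = (2 : ℝ) ^ (-m / 2)) :
    2 * ((q : ℝ) + t - 2 * τ + 2 * ℓ) + (4 * (e : ℝ) - 2 * c - ρ + 2 * g + 2 * β) ≤ m := by
  have h := half_m_lower hV hC hI hm
  unfold ExplicitGZAtPhi at hD
  unfold LowerBalanceAtPhi at hE
  have hD' : ((k : ℝ)) + kbar = g + q + t - 2 * τ + a := by exact_mod_cast hD
  have hE' : (β : ℝ) ≤ k - kbar := by exact_mod_cast hE
  linarith

/-- **T6 (PROVED, integer currency of S2′).** With `m ∈ ℤ` the conclusion is the integer inequality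
`2(q + t − 2τ + 2ℓ) + e_A⁻ ≤ m`, i.e. the `≥` half of S2′'s `m = 2(…) + e_A` that LOWER consumes. -/
theorem m_lower_of_engine_int {G0 Lin Sstar : ℂ_[2]} {c e k kbar g q t τ β ℓ ρ a m : ℤ}
    (hV : OddCosetValueLaw G0 Lin Sstar c) (hC : ColemanBoundAtTwo Sstar e k ℓ)
    (hI : InRangeAtPhi Lin ρ a) (hD : ExplicitGZAtPhi k kbar g q t τ a) (hE : LowerBalanceAtPhi k kbar β)
    (hm : ‖G0‖ = (2 : ℝ) ^ (-(m : ℝ) / 2)) :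
    2 * (q + t - 2 * τ + 2 * ℓ) + (4 * e - 2 * c - ρ + 2 * g + 2 * β) ≤ m := by
  have h := m_lower_of_engine hV hC hI hD hE hm
  exact_mod_cast h

/-! ### §4. The per-member WITNESS RECORD the three research inputs must deliver, and the PROVED
derivation of the limit law from it (no existence is asserted: a `structure`, not an `∃`) -/

/-- **The odd-coset engine's deliverables for ONE member** (`G0` = its S2′ value, `Lin` = the partner's
in-range value): the Katz-side in-range values `Ka n`, `Kb n` at the `v`-ramified points `ε⋆Λ^{2ⁿ}`,
`ε'⋆Λ^{2ⁿ}` (de Shalit (36)–(37)), the BDP-side CM-period sums `S n` at weights `j_n = 2ⁿ − 1` (odd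
coset) with their limit `S⋆` (H_B), the in-range identities with constants `w n` (Rankin factorisation +
explicit Waldspurger in range, H_W) and the UNIFORM bound `‖w n‖ ≤ 2^c` (the only one-sided input). -/
structure OddCosetWitness (G0 Lin : ℂ_[2]) (c : ℤ) where
  /-- Katz value of the member's branch at the `n`-th in-range (ramified) point. -/
  Ka : ℕ → ℂ_[2]
  /-- Katz value of the partner's branch at the `n`-th in-range point. -/
  Kb : ℕ → ℂ_[2]
  /-- the in-range constants (Gauss sums, factorial ratios, periods, local toric integrals). -/
  w : ℕ → ℂ_[2]
  /-- the BDP-side normalised CM-period sums at weight `j_n = 2ⁿ − 1`. -/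
  S : ℕ → ℂ_[2]
  /-- the BDP-side limit `θ^{-1} f₀^♭` summed over `Pic 𝒪_{2^{n_v} c₀}` against `φ_δ χ'`. -/
  Sstar : ℂ_[2]
  /-- in-range identity at every level (classical: Rankin = product of two Hecke `L`-values,
  Waldspurger, Katz (36) on both factors). -/
  inRange : ∀ n, Ka n * Kb n = w n * S n ^ 2
  /-- the ONE one-sided research input: a uniform bound on the constants. -/
  bound : ∀ n, ‖w n‖ ≤ (2 : ℝ) ^ (c : ℝ)
  /-- Katz-side continuity (PROVED in §2 once the points are typed: `T_n → 0`). -/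
  limKa : Tendsto Ka atTop (𝓝 G0)
  /-- idem for the partner's branch (its limit point is IN RANGE: `Lin`). -/
  limKb : Tendsto Kb atTop (𝓝 Lin)
  /-- H_B: odd-coset sequential continuity of the CM values of `θ^{2ⁿ−1} f₀^♭` at `p = 2`. -/
  limS : Tendsto S atTop (𝓝 Sstar)

/-- **PROVED: a witness record yields the limit law (V-lim).** -/
theorem OddCosetWitness.valueLaw {G0 Lin : ℂ_[2]} {c : ℤ} (D : OddCosetWitness G0 Lin c) :
    OddCosetValueLaw G0 Lin D.Sstar c := by
  unfold OddCosetValueLaw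
  have hM : Tendsto (fun n => D.Ka n * D.Kb n) atTop (𝓝 (G0 * Lin)) := D.limKa.mul D.limKb
  have hle : ∀ n, ‖D.Ka n * D.Kb n‖ ≤ (2 : ℝ) ^ (c : ℝ) * ‖D.S n‖ ^ 2 := by
    intro n
    rw [D.inRange n, norm_mul, norm_pow]
    exact mul_le_mul_of_nonneg_right (D.bound n) (by positivity)
  have := norm_le_mul_sq_of_tendsto hle hM D.limS
  simpa [norm_mul] using this

/-- **PROVED: the whole LOWER chain from a witness record** (+ Coleman bound, in-range value, explicit
GZ, one-sided balance): the integer inequality `2(q + t − 2τ + 2ℓ) + e_A⁻ ≤ m`. -/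
theorem OddCosetWitness.m_lower {G0 Lin : ℂ_[2]} {c e k kbar g q t τ β ℓ ρ a m : ℤ}
    (D : OddCosetWitness G0 Lin c) (hC : ColemanBoundAtTwo D.Sstar e k ℓ)
    (hI : InRangeAtPhi Lin ρ a) (hD : ExplicitGZAtPhi k kbar g q t τ a) (hE : LowerBalanceAtPhi k kbar β)
    (hm : ‖G0‖ = (2 : ℝ) ^ (-(m : ℝ) / 2)) :
    2 * (q + t - 2 * τ + 2 * ℓ) + (4 * e - 2 * c - ρ + 2 * g + 2 * β) ≤ m :=
  m_lower_of_engine_int D.valueLaw hC hI hD hE hm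

/-- **PROVED: Katz-side fields of the record come for free from §2** — given the S2′ branch `G`, any
sequence of in-range points `T n → 0` with values `Ka n`, the field `limKa` holds with `G0 = G(0)`. -/
theorem limKa_of_points {G : PowerSeries (PadicComplexInt 2)} {T Ka : ℕ → ℂ_[2]}
    (hT : Tendsto T atTop (𝓝 0)) (hKa : ∀ n, IntSeries.HasValueAt G (T n) (Ka n)) :
    Tendsto Ka atTop (𝓝 ((PowerSeries.constantCoeff G : PadicComplexInt 2) : ℂ_[2])) :=
  tendsto_constantCoeff_of_hasValueAt hT hKa

end Summit.BirchSwinnertonDyer.BirchSwinnertonDyer.Cruxes.SplitBadTwoLowerHalfOfFacts.HeegnerIndexTwo.K1G6
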